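import Summits.QuantumAdvantage.QuantumAdvantage.Theses.SpikesNeedAddresses
import Literature.Computability.Complexity.PromiseZPPProofs

/-! Crux-strategist r1 (2026-08-17), stmt-QuantumAdvantage-11702 `PromiseTransfer`.

HAND PROOF of the converse direction `S → C`: the summit `QuantumAdvantage` (∃ L ∈ BQP, L ∉ BPP) makes the
second hypothesis `PromiseBQP ⊆ PromiseBPP'` of `PromiseTransfer` FALSE (embed `L` as the trivial-promise
problem `PromiseProblem.ofLanguage L`; tree lemmas `ofLanguage_mem_PromiseBQP_iff`,
`ofLanguage_mem_PromiseBPP'_iff`), so `PromiseTransfer` holds vacuously.  Hence `PromiseTransfer` is a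
CONSEQUENCE of the summit: it is at most summit-strength, and it is summit-EQUIVALENT iff
`PromiseTransfer → QuantumAdvantage`, i.e. iff the summit is provable outright from a statement that the
route plans to prove by relativizing query-complexity tools (AA14 Thm 21/23, Zhandry 2012, Bennett–Gill).
-/

namespace Summit.QuantumAdvantage.QuantumAdvantage.Cruxes.PromiseTransfer.StrategistR1

open Summit.QuantumAdvantage.QuantumAdvantage.Theses.SpikesNeedAddresses

/-- `S → C`: the summit implies the crux (vacuously, by killing its second hypothesis). -/
theorem promiseTransfer_of_summit (hS : _root_.QuantumAdvantage) : PromiseTransfer := by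
  intro _hAA hsub
  obtain ⟨L, hL, hL'⟩ := hS
  exact (hL' (Literature.Computability.Complexity.ofLanguage_mem_PromiseBPP'_iff.mp
    (hsub (Literature.Computability.Cryptography.ofLanguage_mem_PromiseBQP_iff.mpr hL)))).elim

/-- Equivalently: the negation of the crux's second hypothesis already gives the summit's contrapositive
shape used in `closes` — `¬(PromiseBQP ⊆ PromiseBPP') ← QuantumAdvantage`. -/
theorem not_promise_collapse_of_summit (hS : _root_.QuantumAdvantage) :
    ¬ (Literature.Computability.Cryptography.PromiseBQP ⊆ Literature.Computability.Complexity.PromiseBPP') := by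
  intro hsub
  obtain ⟨L, hL, hL'⟩ := hS
  exact hL' (Literature.Computability.Complexity.ofLanguage_mem_PromiseBPP'_iff.mp
    (hsub (Literature.Computability.Cryptography.ofLanguage_mem_PromiseBQP_iff.mpr hL)))

end Summit.QuantumAdvantage.QuantumAdvantage.Cruxes.PromiseTransfer.StrategistR1
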